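import Literature.NumberTheory.LFunctions.Zhang2022.Section8Defs

/-!
# Zhang (2022) §8: the main terms of Lemmas 8.2/8.4 and the passage to (8.13)–(8.18)

Trunk T-ANT (NumberTheory/LFunctions). Companion of `Section8Defs.lean`, `Section8ClosedForm.lean`,
`Section8Certificate.lean` (Y. Zhang, *Discrete mean estimates and the Landau–Siegel zero*,
arXiv:2211.02515v1 (2022) [Zhang2022LandauSiegel], §8; **an unrefereed manuscript, a claimed result
under adjudication** — this file reproduces two finite computations of the manuscript and asserts
nothing about its theorems).

`Section8Defs` transcribes the twelve printed closed forms `𝔣𝔣_{jμ}`, `𝔤𝔥_{jμ}` of (8.13)–(8.18) and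
records in its docstring what it deliberately leaves out: "the analysis of §§6–8 that leads to
(8.11)–(8.12) (Proposition 7.1, Lemmas 8.2–8.4, the passage `𝔣(Pᶻ) = 𝔣𝔣(z) + O(ℒ⁻⁸)`)". This file
kernel-checks the last, purely computational links of that omitted chain:

1. **Lemma 8.2, "the result now follows by direct calculation"** [pp. 16–17 of the source]. Its
   main term is `𝔣_{jμ}(x) = (1 + (β_μ − β_j) log x) x^{β_μ}` and its proof ends with the contour
   integral `(2πi)⁻¹ ∮_{|s| = 5α} xˢ (s − β_j)(s − β_μ)⁻² ds` (after `L(1 − β_j + s, χ)` has been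
   replaced by `L′(1,χ)(s − β_j)`). `circleIntegral_lemma82` PROVES, for any circle containing `β_μ`
   and with `xˢ := e^{sL}`, `L = log x` (any `L ∈ ℂ`):
   `(2πi)⁻¹ ∮ e^{sL}(s − β_j)/(s − β_μ)² ds = 𝔣_{jμ}` (`frakf`) — Cauchy's formula and Cauchy's
   formula for the derivative (Mathlib) after splitting `s − β_j = (s − β_μ) + (β_μ − β_j)`.
2. **Lemma 8.4, same words** [p. 17]. Main term
   `𝔤_{jμ}(x) = β_{j+1}β_{j+2}β_μ⁻²
     + (1 − β_{j+1}β_{j+2}β_μ⁻² − (β_{j+1} − β_μ)(β_{j+2} − β_μ)β_μ⁻¹ log x) x^{−β_μ}`,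
   integral `(2πi)⁻¹ ∮_{|s| = 5α} (s + β_{j+1})(s + β_{j+2}) s⁻¹ (s + β_μ)⁻² xˢ ds`.
   `circleIntegral_lemma84` PROVES it equals `𝔤_{jμ}` (`frakg`) for any circle containing `0` and
   `−β_μ`, `β_μ ≠ 0`: partial fractions `A/s + B/(s + β_μ) + C/(s + β_μ)²` with
   `A = β_{j+1}β_{j+2}/β_μ²`, `B = 1 − A`, `C = −(β_{j+1} − β_μ)(β_{j+2} − β_μ)/β_μ`, then the two
   Cauchy formulae. (So the two printed main terms are exactly the residue sums of the printed
   integrands; the manuscript's error terms `O(ℒ⁻⁶)` are not touched.)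
3. **The passage to (8.13)–(8.18).** With the MAIN VALUES of the shifts, `β_j⁰ = jiα` (`j = 1,2,3`;
   the manuscript's `β_j = β_j⁰(1 + O(αℒ))`, (2.13)), `β₆ = 3iα/2`, `β₇ = 5iα/2` ((2.22)), the
   convention `β₄ = β₁, β₅ = β₂` (§8, before Lemma 8.2), `x = Pᶻ` and `α log P = π` ((2.10)):
   `frakf_main_16, …, frakg_main_37` PROVE `𝔣_{jμ}(Pᶻ) = 𝔣𝔣_{jμ}(z)` and
   `𝔤_{jμ}(Pᶻ) = 𝔤𝔥_{jμ}(z)` EXACTLY for all twelve `(j, μ)`, i.e. the printed (8.13)–(8.18) are the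
   correct specialisations (the manuscript's `+ O(ℒ⁻⁸)` comes only from
   `β_j − β_j⁰ = O(α²ℒ)`, (2.13), since `αℒ = πℒ⁻⁸` by (2.6) `P = exp ℒ⁹` and (2.10)).
   `lemma82_main_*`, `lemma84_main_*` combine 1–3: each printed `𝔣𝔣`, `𝔤𝔥` IS the value of the
   corresponding contour integral on the manuscript's circle `|s| = 5α` (`α > 0`).
4. `betaMain_mul_mul_log`: `β_a⁰ β_b⁰ log P = −ab·πα`, the identity behind
   "`β_{j+1}β_{j+2} log P = −(11 − 6j + j²)πα + o(α)`" of §10 (display before (10.12);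
   `(j+1)(j+2) ↦ 6, 3, 2` for `j = 1, 2, 3` under `β₄ = β₁, β₅ = β₂`; `index_product_values`).

Consequence for the record (no new claim): together with `Section8ClosedForm`/`Section8Certificate`
the kernel now carries the chain from the displayed integrands of Lemmas 8.2/8.4, taken at the main
values of the shifts, to `not_ineq824 : ¬(𝔠₁ < 6.9955)`; what remains outside the kernel in §§7–8
is the analytic number theory proper (Proposition 7.1; the contour shifts and error terms `O(ℒ⁻⁶)`
of Lemmas 8.2–8.4 under hypothesis (A); Lemma 8.3 / Appendix A; the identity (8.10), the partial
summation (8.11), (8.12) and its change of variables `x = Pᶻ` into (8.19)–(8.22)).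

Design: `x` enters `𝔣_{jμ}(x)`, `𝔤_{jμ}(x)` only through `log x` and `x^{±β} = e^{±β log x}`, so
both are defined as functions of `L = log x ∈ ℂ`; the shifts are free complex parameters in 1–2 and
the main values `betaMain j α = j·i·α` (`j ∈ ℚ`, covering `3/2, 5/2`) in 3–4. General centre `c` and
radius `R` in 1–2; the manuscript's `c = 0`, `R = 5α` in the `lemma82_main_*`/`lemma84_main_*`.
-/

noncomputable section

open Complex Real Metric Set

namespace Literature.NumberTheory.LFunctions.Zhang2022

/-! ### The generic main terms -/

/-- Lemma 8.2's main term as a function of the shifts and of `L = log x`: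
`𝔣_{jμ}(x) = (1 + (β_μ − β_j) log x) x^{β_μ}`, `x^{β_μ} := e^{β_μ log x}`.
[cite: Zhang2022LandauSiegel, Lemma 8.2] -/
def frakf (βj βμ L : ℂ) : ℂ := (1 + (βμ - βj) * L) * cexp (βμ * L)

/-- Lemma 8.4's main term as a function of the shifts (`β1, β2` standing for `β_{j+1}, β_{j+2}`)
and of `L = log x`: `𝔤_{jμ}(x) = β_{j+1}β_{j+2}/β_μ² + (1 − β_{j+1}β_{j+2}/β_μ²
− (β_{j+1} − β_μ)(β_{j+2} − β_μ)/β_μ · log x) x^{−β_μ}`. [cite: Zhang2022LandauSiegel, Lemma 8.4] -/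
def frakg (β1 β2 βμ L : ℂ) : ℂ :=
  β1 * β2 / βμ ^ 2 + (1 - β1 * β2 / βμ ^ 2 - (β1 - βμ) * (β2 - βμ) / βμ * L) * cexp (-(βμ * L))

/-! ### Lemma 8.2: the "direct calculation" -/

/-- **Lemma 8.2, last step** ("The result now follows by direct calculation"): for every circle
`C(c, R)` containing `β_μ` in its interior and every `L ∈ ℂ` (`L = log x`, `xˢ = e^{sL}`),
`(2πi)⁻¹ ∮_{C(c,R)} e^{sL}(s − β_j)(s − β_μ)⁻² ds = 𝔣_{jμ}`. The manuscript's circle is `|s| = 5α`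
(`c = 0`, `R = 5α`, `|β_μ| ∈ {3α/2, 5α/2}`). Proof: `s − β_j = (s − β_μ) + (β_μ − β_j)`, Cauchy's
integral formula for `e^{sL}` at `β_μ` and Cauchy's formula for its derivative `L e^{β_μ L}`.
[cite: Zhang2022LandauSiegel, Lemma 8.2 (proof)] -/
theorem circleIntegral_lemma82 (βj βμ L : ℂ) {c : ℂ} {R : ℝ} (hμ : βμ ∈ ball c R) :
    (2 * π * I)⁻¹ * (∮ s in C(c, R), cexp (s * L) * (s - βj) / (s - βμ) ^ 2) = frakf βj βμ L := by
  have hR : 0 < R := pos_of_mem_ball hμ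
  set f : ℂ → ℂ := fun s => cexp (s * L) with hf_def
  have hf : Differentiable ℂ f := fun s => ((differentiable_id.mul_const L).cexp) s
  have hne : ∀ s ∈ sphere c R, s - βμ ≠ 0 := fun s hs h =>
    (sphere_disjoint_ball.ne_of_mem hs hμ) (sub_eq_zero.mp h)
  have hcongr : EqOn (fun s => cexp (s * L) * (s - βj) / (s - βμ) ^ 2)
      (fun s => (s - βμ)⁻¹ * f s + (βμ - βj) * (((s - βμ) ^ 2)⁻¹ * f s)) (sphere c R) := by
    intro s hs
    have h := hne s hs
    simp only [hf_def]
    field_simp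
    ring
  rw [circleIntegral.integral_congr hR.le hcongr]
  have hc1 : ContinuousOn (fun s : ℂ => (s - βμ)⁻¹) (sphere c R) :=
    (continuousOn_id.sub continuousOn_const).inv₀ hne
  have hc2 : ContinuousOn (fun s : ℂ => ((s - βμ) ^ 2)⁻¹) (sphere c R) :=
    ((continuousOn_id.sub continuousOn_const).pow 2).inv₀ (fun s hs => pow_ne_zero 2 (hne s hs))
  have hi1 : CircleIntegrable (fun s => (s - βμ)⁻¹ * f s) c R :=
    (hc1.mul hf.continuous.continuousOn).circleIntegrable hR.le
  have hi2 : CircleIntegrable (fun s => (βμ - βj) * (((s - βμ) ^ 2)⁻¹ * f s)) c R :=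
    (continuousOn_const.mul (hc2.mul hf.continuous.continuousOn)).circleIntegrable hR.le
  rw [circleIntegral.integral_add hi1 hi2, circleIntegral.integral_const_mul, mul_add]
  have h1 : (2 * π * I)⁻¹ * (∮ s in C(c, R), (s - βμ)⁻¹ * f s) = f βμ := by
    have := (hf.diffContOnCl (s := ball c R)).two_pi_i_inv_smul_circleIntegral_sub_inv_smul hμ
    simpa only [smul_eq_mul] using this
  have h2 : (2 * π * I)⁻¹ * (∮ s in C(c, R), ((s - βμ) ^ 2)⁻¹ * f s) = deriv f βμ := by
    have := Complex.two_pi_I_inv_smul_circleIntegral_sub_sq_inv_smul_of_differentiable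
      isOpen_univ (subset_univ _) hf.differentiableOn hμ
    simpa only [smul_eq_mul] using this
  have hderiv : deriv f βμ = L * cexp (βμ * L) := by
    have : HasDerivAt f (cexp (βμ * L) * (1 * L)) βμ :=
      (Complex.hasDerivAt_exp (βμ * L)).comp βμ ((hasDerivAt_id βμ).mul_const L)
    rw [this.deriv]; ring
  calc (2 * π * I)⁻¹ * (∮ s in C(c, R), (s - βμ)⁻¹ * f s)
        + (2 * π * I)⁻¹ * ((βμ - βj) * ∮ s in C(c, R), ((s - βμ) ^ 2)⁻¹ * f s)
      = f βμ + (βμ - βj) * deriv f βμ := by rw [← h1, ← h2]; ring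
    _ = frakf βj βμ L := by rw [hderiv]; simp only [hf_def, frakf]; ring

/-! ### Lemma 8.4: the "direct calculation" -/

/-- **Lemma 8.4, last step** ("The result now follows by direct calculation"): for every circle
`C(c, R)` containing `0` and `−β_μ` in its interior, `β_μ ≠ 0`, and every `L ∈ ℂ`,
`(2πi)⁻¹ ∮_{C(c,R)} (s + β_{j+1})(s + β_{j+2}) e^{sL} / (s (s + β_μ)²) ds = 𝔤_{jμ}`. The
manuscript's circle is `|s| = 5α`. Proof: the partial fractions
`(s + β_{j+1})(s + β_{j+2})/(s(s + β_μ)²) = A/s + B/(s + β_μ) + C/(s + β_μ)²`,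
`A = β_{j+1}β_{j+2}/β_μ²`, `B = 1 − A`, `C = −(β_{j+1} − β_μ)(β_{j+2} − β_μ)/β_μ` (valid on the
circle, where `s ≠ 0, −β_μ`), then Cauchy's formula at `0` and at `−β_μ` and Cauchy's formula for
the derivative at `−β_μ`: `A·1 + B e^{−β_μL} + C L e^{−β_μL} = 𝔤_{jμ}`.
[cite: Zhang2022LandauSiegel, Lemma 8.4 (proof)] -/
theorem circleIntegral_lemma84 (β1 β2 βμ L : ℂ) {c : ℂ} {R : ℝ} (h0 : (0 : ℂ) ∈ ball c R)
    (hμ : -βμ ∈ ball c R) (hμ0 : βμ ≠ 0) :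
    (2 * π * I)⁻¹ * (∮ s in C(c, R), (s + β1) * (s + β2) * cexp (s * L) / (s * (s + βμ) ^ 2))
      = frakg β1 β2 βμ L := by
  have hR : 0 < R := pos_of_mem_ball hμ
  set f : ℂ → ℂ := fun s => cexp (s * L) with hf_def
  have hf : Differentiable ℂ f := fun s => ((differentiable_id.mul_const L).cexp) s
  set A : ℂ := β1 * β2 / βμ ^ 2 with hA
  set B : ℂ := 1 - β1 * β2 / βμ ^ 2 with hB
  set C : ℂ := -((β1 - βμ) * (β2 - βμ) / βμ) with hC
  have hne0 : ∀ s ∈ sphere c R, s - 0 ≠ 0 := fun s hs h =>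
    (sphere_disjoint_ball.ne_of_mem hs h0) (sub_eq_zero.mp h)
  have hneμ : ∀ s ∈ sphere c R, s - -βμ ≠ 0 := fun s hs h =>
    (sphere_disjoint_ball.ne_of_mem hs hμ) (sub_eq_zero.mp h)
  have hcongr : EqOn (fun s => (s + β1) * (s + β2) * cexp (s * L) / (s * (s + βμ) ^ 2))
      (fun s => A * ((s - 0)⁻¹ * f s) + (B * ((s - -βμ)⁻¹ * f s)
        + C * (((s - -βμ) ^ 2)⁻¹ * f s))) (sphere c R) := by
    intro s hs
    have h1 := hne0 s hs
    have h2 := hneμ s hs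
    rw [sub_zero] at h1
    rw [sub_neg_eq_add] at h2
    simp only [hf_def, hA, hB, hC, sub_zero, sub_neg_eq_add]
    field_simp
    ring
  rw [circleIntegral.integral_congr hR.le hcongr]
  have hc0 : ContinuousOn (fun s : ℂ => (s - 0)⁻¹) (sphere c R) :=
    (continuousOn_id.sub continuousOn_const).inv₀ hne0
  have hc1 : ContinuousOn (fun s : ℂ => (s - -βμ)⁻¹) (sphere c R) :=
    (continuousOn_id.sub continuousOn_const).inv₀ hneμ
  have hc2 : ContinuousOn (fun s : ℂ => ((s - -βμ) ^ 2)⁻¹) (sphere c R) :=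
    ((continuousOn_id.sub continuousOn_const).pow 2).inv₀ (fun s hs => pow_ne_zero 2 (hneμ s hs))
  have hfc : ContinuousOn f (sphere c R) := hf.continuous.continuousOn
  have hi0 : CircleIntegrable (fun s => A * ((s - 0)⁻¹ * f s)) c R :=
    (continuousOn_const.mul (hc0.mul hfc)).circleIntegrable hR.le
  have hi1 : CircleIntegrable (fun s => B * ((s - -βμ)⁻¹ * f s)) c R :=
    (continuousOn_const.mul (hc1.mul hfc)).circleIntegrable hR.le
  have hi2 : CircleIntegrable (fun s => C * (((s - -βμ) ^ 2)⁻¹ * f s)) c R :=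
    (continuousOn_const.mul (hc2.mul hfc)).circleIntegrable hR.le
  have hi12 : CircleIntegrable (fun s => B * ((s - -βμ)⁻¹ * f s)
      + C * (((s - -βμ) ^ 2)⁻¹ * f s)) c R := hi1.add hi2
  rw [circleIntegral.integral_add hi0 hi12, circleIntegral.integral_add hi1 hi2,
    circleIntegral.integral_const_mul, circleIntegral.integral_const_mul,
    circleIntegral.integral_const_mul]
  have hv0 : (2 * π * I)⁻¹ * (∮ s in C(c, R), (s - 0)⁻¹ * f s) = f 0 := by
    have := (hf.diffContOnCl (s := ball c R)).two_pi_i_inv_smul_circleIntegral_sub_inv_smul h0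
    simpa only [smul_eq_mul] using this
  have hv1 : (2 * π * I)⁻¹ * (∮ s in C(c, R), (s - -βμ)⁻¹ * f s) = f (-βμ) := by
    have := (hf.diffContOnCl (s := ball c R)).two_pi_i_inv_smul_circleIntegral_sub_inv_smul hμ
    simpa only [smul_eq_mul] using this
  have hv2 : (2 * π * I)⁻¹ * (∮ s in C(c, R), ((s - -βμ) ^ 2)⁻¹ * f s) = deriv f (-βμ) := by
    have := Complex.two_pi_I_inv_smul_circleIntegral_sub_sq_inv_smul_of_differentiable
      isOpen_univ (subset_univ _) hf.differentiableOn hμ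
    simpa only [smul_eq_mul] using this
  have hderiv : deriv f (-βμ) = L * cexp (-(βμ * L)) := by
    have : HasDerivAt f (cexp (-βμ * L) * (1 * L)) (-βμ) :=
      (Complex.hasDerivAt_exp (-βμ * L)).comp (-βμ) ((hasDerivAt_id (-βμ)).mul_const L)
    rw [this.deriv, neg_mul]; ring
  have hf0 : f 0 = 1 := by simp [hf_def]
  have hfμ : f (-βμ) = cexp (-(βμ * L)) := by simp [hf_def]
  calc (2 * π * I)⁻¹ * (A * (∮ s in C(c, R), (s - 0)⁻¹ * f s)
          + (B * (∮ s in C(c, R), (s - -βμ)⁻¹ * f s) + C * ∮ s in C(c, R), ((s - -βμ) ^ 2)⁻¹ * f s))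
      = A * f 0 + B * f (-βμ) + C * deriv f (-βμ) := by rw [← hv0, ← hv1, ← hv2]; ring
    _ = frakg β1 β2 βμ L := by
        rw [hderiv, hf0, hfμ]; simp only [hA, hB, hC, frakg]; ring

/-! ### The main values of the shifts and the passage to (8.13)–(8.18) -/

/-- The main value `β_j⁰ = j·i·α` of the shift `β_j` ((2.13): `β₁ = iα(1 − 5c′αℒ)`,
`β₂ = 2iα(1 + c′αℒ)`, `β₃ = 3iα(1 − c′αℒ)`; (2.22): `β₆ = 3iα/2`, `β₇ = 5iα/2` exactly), indexed by
`j ∈ ℚ` so that `j = 3/2, 5/2` give `β₆, β₇`. [cite: Zhang2022LandauSiegel, (2.13), (2.22)] -/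
def betaMain (j : ℚ) (α : ℝ) : ℂ := (j : ℂ) * I * α

/-- `‖β_j⁰‖ = |j|·|α|`. [cite: Zhang2022LandauSiegel, (2.13), (2.22)] -/
theorem norm_betaMain (j : ℚ) (α : ℝ) : ‖betaMain j α‖ = |(j : ℝ)| * |α| := by
  unfold betaMain
  rw [norm_mul, norm_mul, Complex.norm_I, mul_one, Complex.norm_ratCast, Complex.norm_real,
    Real.norm_eq_abs]

/-- For `α > 0` and `|j| < 5`, `β_j⁰` lies inside the manuscript's circle `|s| = 5α`
(used with `j = 3/2, 5/2`, i.e. `β₆, β₇`, and their negatives).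
[cite: Zhang2022LandauSiegel, Lemma 8.2 (proof)] -/
theorem betaMain_mem_ball {j : ℚ} {α : ℝ} (hj : |(j : ℝ)| < 5) (hα : 0 < α) :
    betaMain j α ∈ ball (0 : ℂ) (5 * α) := by
  rw [mem_ball, dist_zero_right, norm_betaMain, abs_of_pos hα]
  exact mul_lt_mul_of_pos_right hj hα

/-- `−β_j⁰ = β_{−j}⁰`. [cite: Zhang2022LandauSiegel, (2.13)] -/
theorem neg_betaMain (j : ℚ) (α : ℝ) : -betaMain j α = betaMain (-j) α := by
  unfold betaMain; push_cast; ring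

/-- `β_j⁰ ≠ 0` for `j ≠ 0`, `α ≠ 0`. [cite: Zhang2022LandauSiegel, (2.13)] -/
theorem betaMain_ne_zero {j : ℚ} {α : ℝ} (hj : j ≠ 0) (hα : α ≠ 0) : betaMain j α ≠ 0 := by
  unfold betaMain
  exact mul_ne_zero (mul_ne_zero (by exact_mod_cast hj) I_ne_zero) (by exact_mod_cast hα)

/-- `β_a⁰ β_b⁰ log P = −ab·πα` when `α log P = π` ((2.10)); with `β₄ = β₁`, `β₅ = β₂` this is the
identity "`β_{j+1}β_{j+2} log P = −(11 − 6j + j²)πα + o(α)`" of §10 at the main values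
(`(j+1)(j+2) ↦ 2·3, 3·1, 1·2 = 6, 3, 2 = 11 − 6j + j²` for `j = 1, 2, 3`, `index_product_values`).
[cite: Zhang2022LandauSiegel, §10 (display before (10.12))] -/
theorem betaMain_mul_mul_log {α Λ : ℝ} (h : α * Λ = π) (a b : ℚ) :
    betaMain a α * betaMain b α * Λ = -((a * b : ℚ) : ℂ) * π * α := by
  have hπ : (π : ℂ) = (α : ℂ) * Λ := by rw [← Complex.ofReal_mul, h]
  unfold betaMain
  rw [hπ]; push_cast
  have hI : I * I = -1 := I_mul_I
  linear_combination (↑a * ↑b * ↑α * ↑α * ↑Λ : ℂ) * hI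

/-- The index polynomial of §10: `11 − 6j + j² = 6, 3, 2` for `j = 1, 2, 3`, i.e. the products
`(j+1)(j+2)` of the cyclic convention `β₄ = β₁, β₅ = β₂`. [cite: Zhang2022LandauSiegel, §10] -/
theorem index_product_values :
    ((11 - 6 * 1 + 1 ^ 2 : ℤ) = 2 * 3) ∧ ((11 - 6 * 2 + 2 ^ 2 : ℤ) = 3 * 1)
      ∧ ((11 - 6 * 3 + 3 ^ 2 : ℤ) = 1 * 2) := by
  norm_num

section Specialisation

variable {α Λ : ℝ}

/-- (8.13), `𝔣`: `𝔣₁₆(Pᶻ) = 𝔣𝔣₁₆(z)` at the main values (`β₁⁰ = iα`, `β₆ = 3iα/2`, `α log P = π`).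
[cite: Zhang2022LandauSiegel, (8.13)] -/
theorem frakf_main_16 (h : α * Λ = π) (z : ℝ) :
    frakf (betaMain 1 α) (betaMain (3/2) α) (z * Λ) = ff16 z := by
  have hπ : (π : ℂ) = (α : ℂ) * Λ := by rw [← Complex.ofReal_mul, h]
  unfold frakf betaMain ff16 ffF
  rw [hπ]; push_cast
  congr 1
  · ring
  · congr 1; ring

/-- (8.14), `𝔣`: `𝔣₂₆(Pᶻ) = 𝔣𝔣₂₆(z)` at the main values. [cite: Zhang2022LandauSiegel, (8.14)] -/
theorem frakf_main_26 (h : α * Λ = π) (z : ℝ) :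
    frakf (betaMain 2 α) (betaMain (3/2) α) (z * Λ) = ff26 z := by
  have hπ : (π : ℂ) = (α : ℂ) * Λ := by rw [← Complex.ofReal_mul, h]
  unfold frakf betaMain ff26 ffF
  rw [hπ]; push_cast
  congr 1
  · ring
  · congr 1; ring

/-- (8.15), `𝔣`: `𝔣₃₆(Pᶻ) = 𝔣𝔣₃₆(z)` at the main values. [cite: Zhang2022LandauSiegel, (8.15)] -/
theorem frakf_main_36 (h : α * Λ = π) (z : ℝ) :
    frakf (betaMain 3 α) (betaMain (3/2) α) (z * Λ) = ff36 z := by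
  have hπ : (π : ℂ) = (α : ℂ) * Λ := by rw [← Complex.ofReal_mul, h]
  unfold frakf betaMain ff36 ffF
  rw [hπ]; push_cast
  congr 1
  · ring
  · congr 1; ring

/-- (8.16), `𝔣`: `𝔣₁₇(Pᶻ) = 𝔣𝔣₁₇(z)` at the main values (`β₇ = 5iα/2`).
[cite: Zhang2022LandauSiegel, (8.16)] -/
theorem frakf_main_17 (h : α * Λ = π) (z : ℝ) :
    frakf (betaMain 1 α) (betaMain (5/2) α) (z * Λ) = ff17 z := by
  have hπ : (π : ℂ) = (α : ℂ) * Λ := by rw [← Complex.ofReal_mul, h]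
  unfold frakf betaMain ff17 ffF
  rw [hπ]; push_cast
  congr 1
  · ring
  · congr 1; ring

/-- (8.17), `𝔣`: `𝔣₂₇(Pᶻ) = 𝔣𝔣₂₇(z)` at the main values. [cite: Zhang2022LandauSiegel, (8.17)] -/
theorem frakf_main_27 (h : α * Λ = π) (z : ℝ) :
    frakf (betaMain 2 α) (betaMain (5/2) α) (z * Λ) = ff27 z := by
  have hπ : (π : ℂ) = (α : ℂ) * Λ := by rw [← Complex.ofReal_mul, h]
  unfold frakf betaMain ff27 ffF
  rw [hπ]; push_cast
  congr 1
  · ring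
  · congr 1; ring

/-- (8.18), `𝔣`: `𝔣₃₇(Pᶻ) = 𝔣𝔣₃₇(z)` at the main values. [cite: Zhang2022LandauSiegel, (8.18)] -/
theorem frakf_main_37 (h : α * Λ = π) (z : ℝ) :
    frakf (betaMain 3 α) (betaMain (5/2) α) (z * Λ) = ff37 z := by
  have hπ : (π : ℂ) = (α : ℂ) * Λ := by rw [← Complex.ofReal_mul, h]
  unfold frakf betaMain ff37 ffF
  rw [hπ]; push_cast
  congr 1
  · ring
  · congr 1; ring

/-- (8.13), `𝔤`: `𝔤₁₆(Pᶻ) = 𝔤𝔥₁₆(z)` at the main values, `(β_{j+1}, β_{j+2}) = (β₂⁰, β₃⁰)`: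
`β₂β₃/β₆² = 8/3`, `−(β₂ − β₆)(β₃ − β₆)/β₆ · z log P = −πiz/2`.
[cite: Zhang2022LandauSiegel, (8.13)] -/
theorem frakg_main_16 (hα : α ≠ 0) (h : α * Λ = π) (z : ℝ) :
    frakg (betaMain 2 α) (betaMain 3 α) (betaMain (3/2) α) (z * Λ) = gh16 z := by
  have hπ : (π : ℂ) = (α : ℂ) * Λ := by rw [← Complex.ofReal_mul, h]
  have hα' : (α : ℂ) ≠ 0 := by exact_mod_cast hα
  unfold frakg betaMain gh16 ghF
  rw [hπ]; push_cast
  congr 1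
  · field_simp; ring_nf
  · congr 1
    · field_simp; ring_nf
    · ring

/-- (8.14), `𝔤`: `𝔤₂₆(Pᶻ) = 𝔤𝔥₂₆(z)`, `(β_{j+1}, β_{j+2}) = (β₃⁰, β₄ = β₁⁰)`: `4/3`, `−1/3`,
`+πiz/2`. [cite: Zhang2022LandauSiegel, (8.14)] -/
theorem frakg_main_26 (hα : α ≠ 0) (h : α * Λ = π) (z : ℝ) :
    frakg (betaMain 3 α) (betaMain 1 α) (betaMain (3/2) α) (z * Λ) = gh26 z := by
  have hπ : (π : ℂ) = (α : ℂ) * Λ := by rw [← Complex.ofReal_mul, h]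
  have hα' : (α : ℂ) ≠ 0 := by exact_mod_cast hα
  unfold frakg betaMain gh26 ghF
  rw [hπ]; push_cast
  congr 1
  · field_simp; ring_nf
  · congr 1
    · field_simp; ring_nf
    · ring

/-- (8.15), `𝔤`: `𝔤₃₆(Pᶻ) = 𝔤𝔥₃₆(z)`, `(β_{j+1}, β_{j+2}) = (β₄, β₅) = (β₁⁰, β₂⁰)`: `8/9`,
`1/9`, `+πiz/6`. [cite: Zhang2022LandauSiegel, (8.15)] -/
theorem frakg_main_36 (hα : α ≠ 0) (h : α * Λ = π) (z : ℝ) :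
    frakg (betaMain 1 α) (betaMain 2 α) (betaMain (3/2) α) (z * Λ) = gh36 z := by
  have hπ : (π : ℂ) = (α : ℂ) * Λ := by rw [← Complex.ofReal_mul, h]
  have hα' : (α : ℂ) ≠ 0 := by exact_mod_cast hα
  unfold frakg betaMain gh36 ghF
  rw [hπ]; push_cast
  congr 1
  · field_simp; ring_nf
  · congr 1
    · field_simp; ring_nf
    · ring

/-- (8.16), `𝔤`: `𝔤₁₇(Pᶻ) = 𝔤𝔥₁₇(z)` (`β₇ = 5iα/2`; `(β₂⁰, β₃⁰)`): `24/25`, `1/25`, `+πiz/10`.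
[cite: Zhang2022LandauSiegel, (8.16)] -/
theorem frakg_main_17 (hα : α ≠ 0) (h : α * Λ = π) (z : ℝ) :
    frakg (betaMain 2 α) (betaMain 3 α) (betaMain (5/2) α) (z * Λ) = gh17 z := by
  have hπ : (π : ℂ) = (α : ℂ) * Λ := by rw [← Complex.ofReal_mul, h]
  have hα' : (α : ℂ) ≠ 0 := by exact_mod_cast hα
  unfold frakg betaMain gh17 ghF
  rw [hπ]; push_cast
  congr 1
  · field_simp; ring_nf
  · congr 1
    · field_simp; ring_nf
    · ring

/-- (8.17), `𝔤`: `𝔤₂₇(Pᶻ) = 𝔤𝔥₂₇(z)` (`(β₃⁰, β₁⁰)`): `12/25`, `13/25`, `+3πiz/10`.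
[cite: Zhang2022LandauSiegel, (8.17)] -/
theorem frakg_main_27 (hα : α ≠ 0) (h : α * Λ = π) (z : ℝ) :
    frakg (betaMain 3 α) (betaMain 1 α) (betaMain (5/2) α) (z * Λ) = gh27 z := by
  have hπ : (π : ℂ) = (α : ℂ) * Λ := by rw [← Complex.ofReal_mul, h]
  have hα' : (α : ℂ) ≠ 0 := by exact_mod_cast hα
  unfold frakg betaMain gh27 ghF
  rw [hπ]; push_cast
  congr 1
  · field_simp; ring_nf
  · congr 1
    · field_simp; ring_nf
    · ring

/-- (8.18), `𝔤`: `𝔤₃₇(Pᶻ) = 𝔤𝔥₃₇(z)` (`(β₁⁰, β₂⁰)`): `8/25`, `17/25`, `−3πiz/10`.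
[cite: Zhang2022LandauSiegel, (8.18)] -/
theorem frakg_main_37 (hα : α ≠ 0) (h : α * Λ = π) (z : ℝ) :
    frakg (betaMain 1 α) (betaMain 2 α) (betaMain (5/2) α) (z * Λ) = gh37 z := by
  have hπ : (π : ℂ) = (α : ℂ) * Λ := by rw [← Complex.ofReal_mul, h]
  have hα' : (α : ℂ) ≠ 0 := by exact_mod_cast hα
  unfold frakg betaMain gh37 ghF
  rw [hπ]; push_cast
  congr 1
  · field_simp; ring_nf
  · congr 1
    · field_simp; ring_nf
    · ring


/-! ### End to end: the printed closed forms are the residue integrals on `|s| = 5α` -/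
/-- (8.13): on the manuscript's circle `|s| = 5α` (`α > 0`), at the main values `β_1⁰ = 1·iα`,
`β₆ = 3iα/2`, with `x = Pᶻ`, `α log P = π`: `(2πi)⁻¹ ∮ xˢ (s − β_1)(s − β_μ)⁻² ds = 𝔣𝔣_{16}(z)`
(Lemma 8.2's integral evaluates to the printed closed form).
[cite: Zhang2022LandauSiegel, Lemma 8.2, (8.13)] -/
theorem lemma82_main_16 (hα : 0 < α) (h : α * Λ = π) (z : ℝ) :
    (2 * π * I)⁻¹ * (∮ s in C((0 : ℂ), 5 * α),
      cexp (s * (z * Λ)) * (s - betaMain 1 α) / (s - betaMain (3/2) α) ^ 2) = ff16 z := by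
  rw [circleIntegral_lemma82 _ _ _ (betaMain_mem_ball (by norm_num) hα), frakf_main_16 h]

/-- (8.14): on the manuscript's circle `|s| = 5α` (`α > 0`), at the main values `β_2⁰ = 2·iα`,
`β₆ = 3iα/2`, with `x = Pᶻ`, `α log P = π`: `(2πi)⁻¹ ∮ xˢ (s − β_2)(s − β_μ)⁻² ds = 𝔣𝔣_{26}(z)`
(Lemma 8.2's integral evaluates to the printed closed form).
[cite: Zhang2022LandauSiegel, Lemma 8.2, (8.14)] -/
theorem lemma82_main_26 (hα : 0 < α) (h : α * Λ = π) (z : ℝ) :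
    (2 * π * I)⁻¹ * (∮ s in C((0 : ℂ), 5 * α),
      cexp (s * (z * Λ)) * (s - betaMain 2 α) / (s - betaMain (3/2) α) ^ 2) = ff26 z := by
  rw [circleIntegral_lemma82 _ _ _ (betaMain_mem_ball (by norm_num) hα), frakf_main_26 h]

/-- (8.15): on the manuscript's circle `|s| = 5α` (`α > 0`), at the main values `β_3⁰ = 3·iα`,
`β₆ = 3iα/2`, with `x = Pᶻ`, `α log P = π`: `(2πi)⁻¹ ∮ xˢ (s − β_3)(s − β_μ)⁻² ds = 𝔣𝔣_{36}(z)`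
(Lemma 8.2's integral evaluates to the printed closed form).
[cite: Zhang2022LandauSiegel, Lemma 8.2, (8.15)] -/
theorem lemma82_main_36 (hα : 0 < α) (h : α * Λ = π) (z : ℝ) :
    (2 * π * I)⁻¹ * (∮ s in C((0 : ℂ), 5 * α),
      cexp (s * (z * Λ)) * (s - betaMain 3 α) / (s - betaMain (3/2) α) ^ 2) = ff36 z := by
  rw [circleIntegral_lemma82 _ _ _ (betaMain_mem_ball (by norm_num) hα), frakf_main_36 h]

/-- (8.16): on the manuscript's circle `|s| = 5α` (`α > 0`), at the main values `β_1⁰ = 1·iα`,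
`β₇ = 5iα/2`, with `x = Pᶻ`, `α log P = π`: `(2πi)⁻¹ ∮ xˢ (s − β_1)(s − β_μ)⁻² ds = 𝔣𝔣_{17}(z)`
(Lemma 8.2's integral evaluates to the printed closed form).
[cite: Zhang2022LandauSiegel, Lemma 8.2, (8.16)] -/
theorem lemma82_main_17 (hα : 0 < α) (h : α * Λ = π) (z : ℝ) :
    (2 * π * I)⁻¹ * (∮ s in C((0 : ℂ), 5 * α),
      cexp (s * (z * Λ)) * (s - betaMain 1 α) / (s - betaMain (5/2) α) ^ 2) = ff17 z := by
  rw [circleIntegral_lemma82 _ _ _ (betaMain_mem_ball (by norm_num) hα), frakf_main_17 h]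

/-- (8.17): on the manuscript's circle `|s| = 5α` (`α > 0`), at the main values `β_2⁰ = 2·iα`,
`β₇ = 5iα/2`, with `x = Pᶻ`, `α log P = π`: `(2πi)⁻¹ ∮ xˢ (s − β_2)(s − β_μ)⁻² ds = 𝔣𝔣_{27}(z)`
(Lemma 8.2's integral evaluates to the printed closed form).
[cite: Zhang2022LandauSiegel, Lemma 8.2, (8.17)] -/
theorem lemma82_main_27 (hα : 0 < α) (h : α * Λ = π) (z : ℝ) :
    (2 * π * I)⁻¹ * (∮ s in C((0 : ℂ), 5 * α),
      cexp (s * (z * Λ)) * (s - betaMain 2 α) / (s - betaMain (5/2) α) ^ 2) = ff27 z := by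
  rw [circleIntegral_lemma82 _ _ _ (betaMain_mem_ball (by norm_num) hα), frakf_main_27 h]

/-- (8.18): on the manuscript's circle `|s| = 5α` (`α > 0`), at the main values `β_3⁰ = 3·iα`,
`β₇ = 5iα/2`, with `x = Pᶻ`, `α log P = π`: `(2πi)⁻¹ ∮ xˢ (s − β_3)(s − β_μ)⁻² ds = 𝔣𝔣_{37}(z)`
(Lemma 8.2's integral evaluates to the printed closed form).
[cite: Zhang2022LandauSiegel, Lemma 8.2, (8.18)] -/
theorem lemma82_main_37 (hα : 0 < α) (h : α * Λ = π) (z : ℝ) :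
    (2 * π * I)⁻¹ * (∮ s in C((0 : ℂ), 5 * α),
      cexp (s * (z * Λ)) * (s - betaMain 3 α) / (s - betaMain (5/2) α) ^ 2) = ff37 z := by
  rw [circleIntegral_lemma82 _ _ _ (betaMain_mem_ball (by norm_num) hα), frakf_main_37 h]

/-- (8.13): on the manuscript's circle `|s| = 5α` (`α > 0`), at the main values
`(β_{j+1}, β_{j+2}) = (2·iα, 3·iα)`, `β₆ = 3iα/2`, with `x = Pᶻ`, `α log P = π`:
`(2πi)⁻¹ ∮ (s + β_{j+1})(s + β_{j+2}) s⁻¹ (s + β_μ)⁻² xˢ ds = 𝔤𝔥_{16}(z)` (Lemma 8.4's integral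
evaluates to the printed closed form). [cite: Zhang2022LandauSiegel, Lemma 8.4, (8.13)] -/
theorem lemma84_main_16 (hα : 0 < α) (h : α * Λ = π) (z : ℝ) :
    (2 * π * I)⁻¹ * (∮ s in C((0 : ℂ), 5 * α), (s + betaMain 2 α) * (s + betaMain 3 α)
      * cexp (s * (z * Λ)) / (s * (s + betaMain (3/2) α) ^ 2)) = gh16 z := by
  rw [circleIntegral_lemma84 _ _ _ _ (mem_ball_self (by positivity))
      (by rw [neg_betaMain]; exact betaMain_mem_ball (by norm_num) hα)
      (betaMain_ne_zero (by norm_num) hα.ne'), frakg_main_16 hα.ne' h]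

/-- (8.14): on the manuscript's circle `|s| = 5α` (`α > 0`), at the main values
`(β_{j+1}, β_{j+2}) = (3·iα, 1·iα)`, `β₆ = 3iα/2`, with `x = Pᶻ`, `α log P = π`:
`(2πi)⁻¹ ∮ (s + β_{j+1})(s + β_{j+2}) s⁻¹ (s + β_μ)⁻² xˢ ds = 𝔤𝔥_{26}(z)` (Lemma 8.4's integral
evaluates to the printed closed form). [cite: Zhang2022LandauSiegel, Lemma 8.4, (8.14)] -/
theorem lemma84_main_26 (hα : 0 < α) (h : α * Λ = π) (z : ℝ) :
    (2 * π * I)⁻¹ * (∮ s in C((0 : ℂ), 5 * α), (s + betaMain 3 α) * (s + betaMain 1 α)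
      * cexp (s * (z * Λ)) / (s * (s + betaMain (3/2) α) ^ 2)) = gh26 z := by
  rw [circleIntegral_lemma84 _ _ _ _ (mem_ball_self (by positivity))
      (by rw [neg_betaMain]; exact betaMain_mem_ball (by norm_num) hα)
      (betaMain_ne_zero (by norm_num) hα.ne'), frakg_main_26 hα.ne' h]

/-- (8.15): on the manuscript's circle `|s| = 5α` (`α > 0`), at the main values
`(β_{j+1}, β_{j+2}) = (1·iα, 2·iα)`, `β₆ = 3iα/2`, with `x = Pᶻ`, `α log P = π`:
`(2πi)⁻¹ ∮ (s + β_{j+1})(s + β_{j+2}) s⁻¹ (s + β_μ)⁻² xˢ ds = 𝔤𝔥_{36}(z)` (Lemma 8.4's integral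
evaluates to the printed closed form). [cite: Zhang2022LandauSiegel, Lemma 8.4, (8.15)] -/
theorem lemma84_main_36 (hα : 0 < α) (h : α * Λ = π) (z : ℝ) :
    (2 * π * I)⁻¹ * (∮ s in C((0 : ℂ), 5 * α), (s + betaMain 1 α) * (s + betaMain 2 α)
      * cexp (s * (z * Λ)) / (s * (s + betaMain (3/2) α) ^ 2)) = gh36 z := by
  rw [circleIntegral_lemma84 _ _ _ _ (mem_ball_self (by positivity))
      (by rw [neg_betaMain]; exact betaMain_mem_ball (by norm_num) hα)
      (betaMain_ne_zero (by norm_num) hα.ne'), frakg_main_36 hα.ne' h]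

/-- (8.16): on the manuscript's circle `|s| = 5α` (`α > 0`), at the main values
`(β_{j+1}, β_{j+2}) = (2·iα, 3·iα)`, `β₇ = 5iα/2`, with `x = Pᶻ`, `α log P = π`:
`(2πi)⁻¹ ∮ (s + β_{j+1})(s + β_{j+2}) s⁻¹ (s + β_μ)⁻² xˢ ds = 𝔤𝔥_{17}(z)` (Lemma 8.4's integral
evaluates to the printed closed form). [cite: Zhang2022LandauSiegel, Lemma 8.4, (8.16)] -/
theorem lemma84_main_17 (hα : 0 < α) (h : α * Λ = π) (z : ℝ) :
    (2 * π * I)⁻¹ * (∮ s in C((0 : ℂ), 5 * α), (s + betaMain 2 α) * (s + betaMain 3 α)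
      * cexp (s * (z * Λ)) / (s * (s + betaMain (5/2) α) ^ 2)) = gh17 z := by
  rw [circleIntegral_lemma84 _ _ _ _ (mem_ball_self (by positivity))
      (by rw [neg_betaMain]; exact betaMain_mem_ball (by norm_num) hα)
      (betaMain_ne_zero (by norm_num) hα.ne'), frakg_main_17 hα.ne' h]

/-- (8.17): on the manuscript's circle `|s| = 5α` (`α > 0`), at the main values
`(β_{j+1}, β_{j+2}) = (3·iα, 1·iα)`, `β₇ = 5iα/2`, with `x = Pᶻ`, `α log P = π`:
`(2πi)⁻¹ ∮ (s + β_{j+1})(s + β_{j+2}) s⁻¹ (s + β_μ)⁻² xˢ ds = 𝔤𝔥_{27}(z)` (Lemma 8.4's integral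
evaluates to the printed closed form). [cite: Zhang2022LandauSiegel, Lemma 8.4, (8.17)] -/
theorem lemma84_main_27 (hα : 0 < α) (h : α * Λ = π) (z : ℝ) :
    (2 * π * I)⁻¹ * (∮ s in C((0 : ℂ), 5 * α), (s + betaMain 3 α) * (s + betaMain 1 α)
      * cexp (s * (z * Λ)) / (s * (s + betaMain (5/2) α) ^ 2)) = gh27 z := by
  rw [circleIntegral_lemma84 _ _ _ _ (mem_ball_self (by positivity))
      (by rw [neg_betaMain]; exact betaMain_mem_ball (by norm_num) hα)
      (betaMain_ne_zero (by norm_num) hα.ne'), frakg_main_27 hα.ne' h]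

/-- (8.18): on the manuscript's circle `|s| = 5α` (`α > 0`), at the main values
`(β_{j+1}, β_{j+2}) = (1·iα, 2·iα)`, `β₇ = 5iα/2`, with `x = Pᶻ`, `α log P = π`:
`(2πi)⁻¹ ∮ (s + β_{j+1})(s + β_{j+2}) s⁻¹ (s + β_μ)⁻² xˢ ds = 𝔤𝔥_{37}(z)` (Lemma 8.4's integral
evaluates to the printed closed form). [cite: Zhang2022LandauSiegel, Lemma 8.4, (8.18)] -/
theorem lemma84_main_37 (hα : 0 < α) (h : α * Λ = π) (z : ℝ) :
    (2 * π * I)⁻¹ * (∮ s in C((0 : ℂ), 5 * α), (s + betaMain 1 α) * (s + betaMain 2 α)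
      * cexp (s * (z * Λ)) / (s * (s + betaMain (5/2) α) ^ 2)) = gh37 z := by
  rw [circleIntegral_lemma84 _ _ _ _ (mem_ball_self (by positivity))
      (by rw [neg_betaMain]; exact betaMain_mem_ball (by norm_num) hα)
      (betaMain_ne_zero (by norm_num) hα.ne'), frakg_main_37 hα.ne' h]

end Specialisation

end Literature.NumberTheory.LFunctions.Zhang2022
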